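import Summits.QuantumFields.YangMills.Theorems.VirialFluxGapDeficitForm
import Summits.QuantumFields.YangMills.Theorems.FemtoTransferGapSlabGround
import Summits.QuantumFields.YangMills.Theorems.LuscherReductionRunningReductionTraceFormulaAveraging
import Literature.Barriers.QuantumFields.ElitzurTheorem
import Literature.MathematicalPhysics.QuantumFieldTheory.FlatLatticeGaugeFields
import Literature.MathematicalPhysics.QuantumFieldTheory.WilsonTorusTransferMatrix
import HarnessLib

/-!
# The gauge action on `2L`-slice ring histories: invariance of the twisted deficit `F_z` and of the ring measure
# (layer (B0) of the DIRECT Laplace road to ⟨stmt-QuantumFields-24204⟩ `VirialFluxGap.SharpTwistedLaplace`)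

Helper module (free-hands work of width seat ym-line-sfw-p2-w2 g49, cell ym-idea-1).  A ring history is a pair
`p = (U⃗, g)` of `2L` slices `U_i : GaugeConfig 3 L SU2` and a seam gauge field `g : Site 3 L → SU2`; the gauge group
`𝒢 = SU(2)^{sites}` acts by `h · (U⃗, g) = ((h·U_i)_i, h g h⁻¹)` (every slice gauge-transformed by the SAME `h`, the seam
field conjugated).  This file supplies, for this action written as an explicit map (no new definition), exactly the
structural inputs `hact ∕ hmul ∕ hone ∕ hpres ∕ hfinv` of the quantitative orbit theorem
`QuantitativeLaplace.laplaceMethod_quantitative_orbit(_tube)`: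

* `ringGaugeAct_mul`, `ringGaugeAct_one` — it is an action;
* `continuous_ringGaugeAct`, `measurable_ringGaugeAct` — joint continuity ∕ measurability of `(h, p) ↦ h · p`;
* `measurePreserving_ringGaugeAct` — the ring measure (product Haar) is invariant (tree: `Elitzur.measurePreserving_gaugeTransform`
  slice by slice, conjugation invariance of Haar on the seam);
* `ringExponent_ringGaugeAct`, ★ `ringDeficit_ringGaugeAct` — the twisted exponent ∕ deficit is invariant for EVERY twist `z`
  (tree: `transferKernel_gaugeTransform`, `TT.gaugeTransform_twist3`, `gaugeTransform_gaugeTransform`).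

Everything here is PROVED; no definitions, no named facts.  HONEST FRAMING: bookkeeping; ⟨24204⟩, ⟨24319⟩ and every rung
stay OPEN; the Yang–Mills mass gap (Clay) is NOT touched; no summit is proved by a line.
-/

noncomputable section

open MeasureTheory Filter Set Function
open scoped BigOperators Topology
open Literature.MathematicalPhysics.QuantumFieldTheory hiding SU2
open Literature.MathematicalPhysics.QuantumLattice (measurePreserving_mul_mul_inv_haarProbability)
open Summit.QuantumFields.YangMills.Theorems.FemtoTransferGap
open Summit.QuantumFields.YangMills.Theorems.FemtoTransferGap.TT

namespace Summit.QuantumFields.YangMills.Theorems.VirialFluxGap.RingDeficit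

variable {L : ℕ} [NeZero L]

/-! ## §1 The action and its algebra -/

omit [NeZero L] in
/-- The gauge action on ring histories is multiplicative: `(h h') · p = h · (h' · p)`. [folklore] -/
theorem ringGaugeAct_mul (h h' : Site 3 L → SU2) (p : (Fin (2 * L - 1 + 1) → GaugeConfig 3 L SU2) × (Site 3 L → SU2)) :
    ((fun i => gaugeTransform (h * h') (p.1 i)), (h * h') * p.2 * (h * h')⁻¹) =
      ((fun i => gaugeTransform h ((fun i => gaugeTransform h' (p.1 i), h' * p.2 * h'⁻¹).1 i)),
        h * ((fun i => gaugeTransform h' (p.1 i), h' * p.2 * h'⁻¹) : (Fin (2 * L - 1 + 1) → GaugeConfig 3 L SU2) ×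
          (Site 3 L → SU2)).2 * h⁻¹) := by
  refine Prod.ext ?_ ?_
  · funext i
    simp only
    rw [gaugeTransform_gaugeTransform]
  · simp only [mul_inv_rev, mul_assoc]

omit [NeZero L] in
/-- The trivial gauge transformation acts trivially. [folklore] -/
theorem ringGaugeAct_one (p : (Fin (2 * L - 1 + 1) → GaugeConfig 3 L SU2) × (Site 3 L → SU2)) :
    ((fun i => gaugeTransform (1 : Site 3 L → SU2) (p.1 i)), (1 : Site 3 L → SU2) * p.2 * (1 : Site 3 L → SU2)⁻¹) = p := by
  refine Prod.ext ?_ ?_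
  · funext i
    exact gaugeTransform_one (p.1 i)
  · simp

/-! ## §2 Continuity, measurability, invariance of the ring measure -/

omit [NeZero L] in
/-- Joint continuity of `(h, p) ↦ h · p`. [folklore] -/
theorem continuous_ringGaugeAct :
    Continuous fun q : (Site 3 L → SU2) × ((Fin (2 * L - 1 + 1) → GaugeConfig 3 L SU2) × (Site 3 L → SU2)) =>
      ((fun i => gaugeTransform q.1 (q.2.1 i), q.1 * q.2.2 * q.1⁻¹) :
        (Fin (2 * L - 1 + 1) → GaugeConfig 3 L SU2) × (Site 3 L → SU2)) := by
  have hK : Continuous fun q : (Site 3 L → SU2) × ((Fin (2 * L - 1 + 1) → GaugeConfig 3 L SU2) × (Site 3 L → SU2)) =>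
      q.1 := continuous_fst
  have hU : Continuous fun q : (Site 3 L → SU2) × ((Fin (2 * L - 1 + 1) → GaugeConfig 3 L SU2) × (Site 3 L → SU2)) =>
      q.2.1 := continuous_fst.comp continuous_snd
  have hg : Continuous fun q : (Site 3 L → SU2) × ((Fin (2 * L - 1 + 1) → GaugeConfig 3 L SU2) × (Site 3 L → SU2)) =>
      q.2.2 := continuous_snd.comp continuous_snd
  refine Continuous.prodMk ?_ ?_
  · refine continuous_pi fun i => continuous_pi fun e => ?_
    have h1 : Continuous fun q : (Site 3 L → SU2) × ((Fin (2 * L - 1 + 1) → GaugeConfig 3 L SU2) × (Site 3 L → SU2)) =>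
        q.1 e.1 := (continuous_apply e.1).comp hK
    have h2 : Continuous fun q : (Site 3 L → SU2) × ((Fin (2 * L - 1 + 1) → GaugeConfig 3 L SU2) × (Site 3 L → SU2)) =>
        q.2.1 i e := (continuous_apply e).comp ((continuous_apply i).comp hU)
    have h3 : Continuous fun q : (Site 3 L → SU2) × ((Fin (2 * L - 1 + 1) → GaugeConfig 3 L SU2) × (Site 3 L → SU2)) =>
        q.1 (e.1.shift e.2) := (continuous_apply _).comp hK
    simp only [gaugeTransform]
    exact (h1.mul h2).mul h3.inv
  · refine continuous_pi fun x => ?_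
    have h1 : Continuous fun q : (Site 3 L → SU2) × ((Fin (2 * L - 1 + 1) → GaugeConfig 3 L SU2) × (Site 3 L → SU2)) =>
        q.1 x := (continuous_apply x).comp hK
    have h2 : Continuous fun q : (Site 3 L → SU2) × ((Fin (2 * L - 1 + 1) → GaugeConfig 3 L SU2) × (Site 3 L → SU2)) =>
        q.2.2 x := (continuous_apply x).comp hg
    simp only [Pi.mul_apply, Pi.inv_apply]
    exact (h1.mul h2).mul h1.inv

omit [NeZero L] in
/-- Joint measurability of `(h, p) ↦ h · p` (the input `hact` of the orbit Laplace theorems); proved structurally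
(products, evaluations, the measurable group operations of `SU(2)`). [folklore] -/
theorem measurable_ringGaugeAct :
    Measurable fun q : (Site 3 L → SU2) × ((Fin (2 * L - 1 + 1) → GaugeConfig 3 L SU2) × (Site 3 L → SU2)) =>
      ((fun i => gaugeTransform q.1 (q.2.1 i), q.1 * q.2.2 * q.1⁻¹) :
        (Fin (2 * L - 1 + 1) → GaugeConfig 3 L SU2) × (Site 3 L → SU2)) := by
  have hK : Measurable fun q : (Site 3 L → SU2) × ((Fin (2 * L - 1 + 1) → GaugeConfig 3 L SU2) × (Site 3 L → SU2)) =>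
      q.1 := measurable_fst
  have hU : Measurable fun q : (Site 3 L → SU2) × ((Fin (2 * L - 1 + 1) → GaugeConfig 3 L SU2) × (Site 3 L → SU2)) =>
      q.2.1 := measurable_fst.comp measurable_snd
  have hg : Measurable fun q : (Site 3 L → SU2) × ((Fin (2 * L - 1 + 1) → GaugeConfig 3 L SU2) × (Site 3 L → SU2)) =>
      q.2.2 := measurable_snd.comp measurable_snd
  refine Measurable.prodMk ?_ ?_
  · refine measurable_pi_lambda _ fun i => measurable_pi_lambda _ fun e => ?_
    have h1 : Measurable fun q : (Site 3 L → SU2) × ((Fin (2 * L - 1 + 1) → GaugeConfig 3 L SU2) × (Site 3 L → SU2)) =>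
        q.1 e.1 := (measurable_pi_apply e.1).comp hK
    have h2 : Measurable fun q : (Site 3 L → SU2) × ((Fin (2 * L - 1 + 1) → GaugeConfig 3 L SU2) × (Site 3 L → SU2)) =>
        q.2.1 i e := (measurable_pi_apply e).comp ((measurable_pi_apply i).comp hU)
    have h3 : Measurable fun q : (Site 3 L → SU2) × ((Fin (2 * L - 1 + 1) → GaugeConfig 3 L SU2) × (Site 3 L → SU2)) =>
        q.1 (e.1.shift e.2) := (measurable_pi_apply _).comp hK
    simp only [gaugeTransform]
    exact (h1.mul h2).mul h3.inv
  · refine measurable_pi_lambda _ fun x => ?_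
    have h1 : Measurable fun q : (Site 3 L → SU2) × ((Fin (2 * L - 1 + 1) → GaugeConfig 3 L SU2) × (Site 3 L → SU2)) =>
        q.1 x := (measurable_pi_apply x).comp hK
    have h2 : Measurable fun q : (Site 3 L → SU2) × ((Fin (2 * L - 1 + 1) → GaugeConfig 3 L SU2) × (Site 3 L → SU2)) =>
        q.2.2 x := (measurable_pi_apply x).comp hg
    simp only [Pi.mul_apply, Pi.inv_apply]
    exact (h1.mul h2).mul h1.inv

/-- ★ **The ring measure is gauge invariant**: `p ↦ h · p` preserves `ringMeasure L` (product Haar on the slices is preserved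
slice by slice, Haar on the seam field is conjugation invariant). [folklore] -/
theorem measurePreserving_ringGaugeAct (h : Site 3 L → SU2) :
    MeasurePreserving (fun p : (Fin (2 * L - 1 + 1) → GaugeConfig 3 L SU2) × (Site 3 L → SU2) =>
      ((fun i => gaugeTransform h (p.1 i), h * p.2 * h⁻¹) :
        (Fin (2 * L - 1 + 1) → GaugeConfig 3 L SU2) × (Site 3 L → SU2))) (ringMeasure L) (ringMeasure L) := by
  haveI : IsProbabilityMeasure (gaugeMeasure L) := by unfold gaugeMeasure; infer_instance
  have h1 : MeasurePreserving (fun Us : Fin (2 * L - 1 + 1) → GaugeConfig 3 L SU2 => fun i => gaugeTransform h (Us i))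
      (Measure.pi fun _ : Fin (2 * L - 1 + 1) => configMeasure SU2 L)
      (Measure.pi fun _ : Fin (2 * L - 1 + 1) => configMeasure SU2 L) :=
    measurePreserving_pi (f := fun (_ : Fin (2 * L - 1 + 1)) (U : GaugeConfig 3 L SU2) => gaugeTransform h U)
      _ _ fun _ => Literature.Barriers.QuantumFields.Elitzur.measurePreserving_gaugeTransform h
  have h2 : MeasurePreserving (fun g : Site 3 L → SU2 => h * g * h⁻¹) (gaugeMeasure L) (gaugeMeasure L) :=
    measurePreserving_pi (f := fun (x : Site 3 L) (u : SU2) => h x * u * (h x)⁻¹) _ _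
      fun x => measurePreserving_mul_mul_inv_haarProbability (h x) (h x)
  exact h1.prod h2

/-- For fixed `h`, `p ↦ h · p` is measurable. [folklore] -/
theorem measurable_ringGaugeAct_left (h : Site 3 L → SU2) :
    Measurable fun p : (Fin (2 * L - 1 + 1) → GaugeConfig 3 L SU2) × (Site 3 L → SU2) =>
      ((fun i => gaugeTransform h (p.1 i), h * p.2 * h⁻¹) :
        (Fin (2 * L - 1 + 1) → GaugeConfig 3 L SU2) × (Site 3 L → SU2)) :=
  (measurePreserving_ringGaugeAct h).measurable

/-! ## §3 Invariance of the twisted exponent and of the deficit -/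

/-- The twisted ring exponent is gauge invariant: every bond kernel `K(h·U_i, h·U_{i+1})` is invariant
(`transferKernel_gaugeTransform`), and the seam kernel `K(h·U_{last}, (hgh⁻¹)·tw_z(h·U_0)) = K(U_{last}, g·tw_z U_0)` because
twists commute with gauge transformations. [cite: Luscher1983, §2] -/
theorem ringExponent_ringGaugeAct (z : Fin 3 → Bool) (h : Site 3 L → SU2)
    (p : (Fin (2 * L - 1 + 1) → GaugeConfig 3 L SU2) × (Site 3 L → SU2)) :
    ringExponent L z ((fun i => gaugeTransform h (p.1 i), h * p.2 * h⁻¹) :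
        (Fin (2 * L - 1 + 1) → GaugeConfig 3 L SU2) × (Site 3 L → SU2)) = ringExponent L z p := by
  rw [ringExponent_eq, ringExponent_eq]
  congr 1
  congr 1
  · exact Finset.prod_congr rfl fun i _ => transferKernel_gaugeTransform su2Rep 1 h _ _
  · simp only
    have hseam : gaugeTransform (h * p.2 * h⁻¹) (twist3 z (gaugeTransform h (p.1 0))) =
        gaugeTransform h (gaugeTransform p.2 (twist3 z (p.1 0))) := by
      rw [← gaugeTransform_twist3, gaugeTransform_gaugeTransform, gaugeTransform_gaugeTransform]
      congr 1
      funext x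
      simp [mul_assoc]
    rw [hseam, transferKernel_gaugeTransform]

/-- ★ **The twisted deficit `F_z` is gauge invariant** (the input `hfinv` of the orbit Laplace theorems). [cite: Luscher1983, §2] -/
theorem ringDeficit_ringGaugeAct (z : Fin 3 → Bool) (h : Site 3 L → SU2)
    (p : (Fin (2 * L - 1 + 1) → GaugeConfig 3 L SU2) × (Site 3 L → SU2)) :
    ringDeficit L z ((fun i => gaugeTransform h (p.1 i), h * p.2 * h⁻¹) :
        (Fin (2 * L - 1 + 1) → GaugeConfig 3 L SU2) × (Site 3 L → SU2)) = ringDeficit L z p := by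
  unfold ringDeficit
  rw [ringExponent_ringGaugeAct]

end Summit.QuantumFields.YangMills.Theorems.VirialFluxGap.RingDeficit
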